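import Literature.Topology.FourManifolds.TautFoliationsCollarTame
import Literature.Topology.FourManifolds.TautFoliationsRadialSquares
import Literature.Topology.FourManifolds.TautFoliationsLeafwiseHeight
import Literature.Topology.FourManifolds.TautFoliationsLocallyInjective
import Literature.Topology.FourManifolds.TautFoliationsDiscFoliation
import HarnessLib

/-!
# The coned collar squares have radial boundary heights

Topic: the coned fence collar (C4a of the plan in the fact seat's NOTES §28–§30). Let `P` be a
cone position of the collar disc `G` of a closed fence `Φ` whose skeleton equals `G` on the edges
of the outer collar (`exists_conePosition_collar`). For a square `Q` of the grid inside the outer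
collar, the boundary heights `P.bdryHt Q = h_{e_Q} ∘ G` on `∂Q` depend only on the distance to
the centre `c₀`: two points of `Q` at the same distance `R` lie on the connected set
`sphere c₀ R ∩ Q` (`isPreconnected_bigSphere_inter_closedBall`), along which `G` is a leafwise
continuous map into the source of `e_Q` (on a ring `G` is a horizontal of the fence read through
the angle), so the heights agree (`height_eq_of_leafwise`). As a function of the radius the
height is continuous and locally a homeomorphism germ of the (affine, injective) level
(`exists_height_germ`), hence strictly monotone (`strictMonoOn_or_strictAntiOn_of_locally_injOn`).
So `ConeSquare.IsRadial` holds and `RadialSquares` describes the contour lines in `Q`.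

* `ConeSquare.isPreconnected_bigSphere_inter_closedBall` (**proved**);
* `SquarePolar.rayPt` and its distance/angle lemmas (**proved**);
* `ConePosition.radialHt` (**definition**), `ConePosition.isRadial_bdryHt` (**proved**).

All statements are [folklore].
-/

noncomputable section

open Set Filter Metric Topology Function Real
open scoped unitInterval

namespace Literature.Topology.FourManifolds

/-! ## A big boundary square cut by a small closed square is preconnected -/

namespace ConeSquare

variable {c₀ c : ℝ × ℝ} {ℓ R : ℝ}

/-- **The part of a big boundary square inside a small closed square is preconnected** (half-side
of the small square `ℓ < R`). [folklore] -/
theorem isPreconnected_bigSphere_inter_closedBall (hℓ : 0 < ℓ) (hR : ℓ < R) :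
    IsPreconnected (sphere c₀ R ∩ closedBall c ℓ) := by
  have hbd : ∀ x ∈ closedBall c ℓ, |x.1 - c.1| ≤ ℓ ∧ |x.2 - c.2| ≤ ℓ := fun x hx ↦ mem_closedBall_iff_coord.1 hx
  -- the pieces: sides of the big square inside the small square
  set sg : Bool → ℝ := fun b ↦ if b then 1 else -1 with hsg
  set V : Bool → Set (ℝ × ℝ) := fun i ↦ closedBall c ℓ ∩ {x | x.1 - c₀.1 = sg i * R} ∩ {x | |x.2 - c₀.2| ≤ R} with hV
  set H : Bool → Set (ℝ × ℝ) := fun j ↦ closedBall c ℓ ∩ {x | x.2 - c₀.2 = sg j * R} ∩ {x | |x.1 - c₀.1| ≤ R} with hH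
  have hsgabs : ∀ b, |sg b * R| = R := fun b ↦ by cases b <;> simp [hsg, abs_of_pos (hℓ.trans hR)]
  -- convexity of the pieces
  have hVc : ∀ i, IsPreconnected (V i) := fun i ↦ by
    refine (Convex.isPreconnected ?_)
    refine ((convex_closedBall c ℓ).inter ?_).inter ?_
    · have : {x : ℝ × ℝ | x.1 - c₀.1 = sg i * R} = (fun x : ℝ × ℝ ↦ x.1) ⁻¹' {c₀.1 + sg i * R} := by
        ext x; simp only [mem_setOf_eq, mem_preimage, mem_singleton_iff]; constructor <;> intro h <;> linarith
      rw [this]; exact (convex_singleton _).linear_preimage (LinearMap.fst ℝ ℝ ℝ)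
    · have : {x : ℝ × ℝ | |x.2 - c₀.2| ≤ R} = (fun x : ℝ × ℝ ↦ x.2) ⁻¹' Icc (c₀.2 - R) (c₀.2 + R) := by
        ext x; simp only [mem_setOf_eq, mem_preimage, mem_Icc, abs_le]; constructor <;> intro h <;> constructor <;> linarith [h.1, h.2]
      rw [this]; exact (convex_Icc _ _).linear_preimage (LinearMap.snd ℝ ℝ ℝ)
  have hHc : ∀ j, IsPreconnected (H j) := fun j ↦ by
    refine (Convex.isPreconnected ?_)
    refine ((convex_closedBall c ℓ).inter ?_).inter ?_
    · have : {x : ℝ × ℝ | x.2 - c₀.2 = sg j * R} = (fun x : ℝ × ℝ ↦ x.2) ⁻¹' {c₀.2 + sg j * R} := by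
        ext x; simp only [mem_setOf_eq, mem_preimage, mem_singleton_iff]; constructor <;> intro h <;> linarith
      rw [this]; exact (convex_singleton _).linear_preimage (LinearMap.snd ℝ ℝ ℝ)
    · have : {x : ℝ × ℝ | |x.1 - c₀.1| ≤ R} = (fun x : ℝ × ℝ ↦ x.1) ⁻¹' Icc (c₀.1 - R) (c₀.1 + R) := by
        ext x; simp only [mem_setOf_eq, mem_preimage, mem_Icc, abs_le]; constructor <;> intro h <;> constructor <;> linarith [h.1, h.2]
      rw [this]; exact (convex_Icc _ _).linear_preimage (LinearMap.fst ℝ ℝ ℝ)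
  -- the set is the cross union
  have heq : sphere c₀ R ∩ closedBall c ℓ = (⋃ i, V i) ∪ ⋃ j, H j := by
    ext x
    rw [mem_inter_iff, mem_sphere_iff_coord]
    simp only [mem_union, mem_iUnion, hV, hH, mem_inter_iff, mem_setOf_eq]
    constructor
    · rintro ⟨(⟨h1, h2⟩ | ⟨h1, h2⟩), hb⟩
      · left
        rcases (abs_eq (hℓ.trans hR).le).1 h1 with h | h
        · exact ⟨true, ⟨hb, by simp [hsg, h]⟩, h2⟩
        · exact ⟨false, ⟨hb, by simp [hsg, h]⟩, h2⟩
      · right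
        rcases (abs_eq (hℓ.trans hR).le).1 h1 with h | h
        · exact ⟨true, ⟨hb, by simp [hsg, h]⟩, h2⟩
        · exact ⟨false, ⟨hb, by simp [hsg, h]⟩, h2⟩
    · rintro (⟨i, ⟨hb, h1⟩, h2⟩ | ⟨j, ⟨hb, h1⟩, h2⟩)
      · exact ⟨Or.inl ⟨by rw [h1]; exact hsgabs i, h2⟩, hb⟩
      · exact ⟨Or.inr ⟨by rw [h1]; exact hsgabs j, h2⟩, hb⟩
  rw [heq]
  -- crossing at the corners
  have hcross : ∀ i j, (V i).Nonempty → (H j).Nonempty → (V i ∩ H j).Nonempty := by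
    intro i j ⟨p, ⟨hpb, hp1⟩, hp2⟩ ⟨p', ⟨hp'b, hp'1⟩, hp'2⟩
    set z : ℝ × ℝ := (c₀.1 + sg i * R, c₀.2 + sg j * R) with hz
    have hz1 : z.1 = p.1 := by simp only [hz]; have : p.1 - c₀.1 = sg i * R := hp1; linarith
    have hz2 : z.2 = p'.2 := by simp only [hz]; have : p'.2 - c₀.2 = sg j * R := hp'1; linarith
    have hzb : z ∈ closedBall c ℓ := by
      rw [mem_closedBall_iff_coord, hz1, hz2]
      exact ⟨(hbd p hpb).1, (hbd p' hp'b).2⟩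
    refine ⟨z, ⟨⟨hzb, by simp [hz]⟩, ?_⟩, ⟨⟨hzb, by simp [hz]⟩, ?_⟩⟩
    · show |z.2 - c₀.2| ≤ R
      simp only [hz, add_sub_cancel_left]; rw [hsgabs]
    · show |z.1 - c₀.1| ≤ R
      simp only [hz, add_sub_cancel_left]; rw [hsgabs]
  -- opposite pieces cannot both be nonempty (the small square is too narrow)
  have hoppV : ¬ ((V false).Nonempty ∧ (V true).Nonempty) := by
    rintro ⟨⟨p, ⟨hpb, hp1⟩, -⟩, ⟨p', ⟨hp'b, hp'1⟩, -⟩⟩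
    have h1 : p.1 - c₀.1 = -1 * R := hp1
    have h2 : p'.1 - c₀.1 = 1 * R := hp'1
    have h3 := (abs_le.1 (hbd p hpb).1).1; have h4 := (abs_le.1 (hbd p' hp'b).1).2
    linarith
  have hoppH : ¬ ((H false).Nonempty ∧ (H true).Nonempty) := by
    rintro ⟨⟨p, ⟨hpb, hp1⟩, -⟩, ⟨p', ⟨hp'b, hp'1⟩, -⟩⟩
    have h1 : p.2 - c₀.2 = -1 * R := hp1
    have h2 : p'.2 - c₀.2 = 1 * R := hp'1
    have h3 := (abs_le.1 (hbd p hpb).2).1; have h4 := (abs_le.1 (hbd p' hp'b).2).2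
    linarith
  -- assemble
  by_cases hVne : ∃ i, (V i).Nonempty
  · by_cases hHne : ∃ j, (H j).Nonempty
    · obtain ⟨i₀, hi₀⟩ := hVne
      obtain ⟨j₀, hj₀⟩ := hHne
      exact isPreconnected_iUnion_union_iUnion hVc hHc hcross hi₀ hj₀
    · push Not at hHne
      have hH0 : (⋃ j, H j) = ∅ := by rw [iUnion_eq_empty]; exact hHne
      rw [hH0, union_empty]
      obtain ⟨i₀, hi₀⟩ := hVne
      have hother : V (!i₀) = ∅ := by
        apply not_nonempty_iff_eq_empty.1
        intro h
        cases i₀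
        · exact hoppV ⟨hi₀, h⟩
        · exact hoppV ⟨h, hi₀⟩
      have hU : (⋃ i, V i) = V i₀ := by
        apply Subset.antisymm
        · refine iUnion_subset fun i ↦ ?_
          by_cases hi : i = i₀
          · rw [hi]
          · have : i = !i₀ := by cases i <;> cases i₀ <;> simp_all
            rw [this, hother]; exact empty_subset _
        · exact subset_iUnion V i₀
      rw [hU]; exact hVc i₀
  · push Not at hVne
    have hV0 : (⋃ i, V i) = ∅ := by rw [iUnion_eq_empty]; exact hVne
    rw [hV0, empty_union]
    by_cases hHne : ∃ j, (H j).Nonempty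
    · obtain ⟨j₀, hj₀⟩ := hHne
      have hother : H (!j₀) = ∅ := by
        apply not_nonempty_iff_eq_empty.1
        intro h
        cases j₀
        · exact hoppH ⟨hj₀, h⟩
        · exact hoppH ⟨h, hj₀⟩
      have hU : (⋃ j, H j) = H j₀ := by
        apply Subset.antisymm
        · refine iUnion_subset fun j ↦ ?_
          by_cases hj : j = j₀
          · rw [hj]
          · have : j = !j₀ := by cases j <;> cases j₀ <;> simp_all
            rw [this, hother]; exact empty_subset _
        · exact subset_iUnion H j₀
      rw [hU]; exact hHc j₀
    · push Not at hHne
      have hH0 : (⋃ j, H j) = ∅ := by rw [iUnion_eq_empty]; exact hHne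
      rw [hH0]; exact isPreconnected_empty

end ConeSquare

/-! ## Points on the ray from the centre -/

namespace SquarePolar

variable {c₀ p : ℝ × ℝ} {R : ℝ}

/-- **The point at distance `R` from `c₀` on the ray through `p`.** [folklore] -/
def rayPt (c₀ p : ℝ × ℝ) (R : ℝ) : ℝ × ℝ := c₀ + (R / dist p c₀) • (p - c₀)

/-- Its distance to the centre is `R`. [folklore] -/
theorem dist_rayPt (hp : p ≠ c₀) (hR : 0 ≤ R) : dist (rayPt c₀ p R) c₀ = R := by
  have hd : 0 < dist p c₀ := dist_pos.2 hp
  rw [rayPt, dist_eq_norm, add_sub_cancel_left, norm_smul, Real.norm_eq_abs, abs_of_nonneg (div_nonneg hR hd.le),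
    ← dist_eq_norm, div_mul_cancel₀ _ hd.ne']

/-- Its distance to `p` is `|R - dist p c₀|`. [folklore] -/
theorem dist_rayPt_self (hp : p ≠ c₀) : dist (rayPt c₀ p R) p = |R - dist p c₀| := by
  have hd : 0 < dist p c₀ := dist_pos.2 hp
  have h : rayPt c₀ p R - p = (R / dist p c₀ - 1) • (p - c₀) := by
    rw [rayPt, sub_smul, one_smul]; abel
  rw [dist_eq_norm, h, norm_smul, Real.norm_eq_abs, ← dist_eq_norm,
    show R / dist p c₀ - 1 = (R - dist p c₀) / dist p c₀ by field_simp, abs_div, abs_of_pos hd, div_mul_cancel₀ _ hd.ne']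

/-- `rayPt` is continuous in the radius. [folklore] -/
theorem continuous_rayPt (c₀ p : ℝ × ℝ) : Continuous (rayPt c₀ p) := by
  unfold rayPt
  exact continuous_const.add ((continuous_id.div_const _).smul continuous_const)

/-- The angle of a ray point is the angle of `p` (positive radius). [folklore] -/
theorem ang_rayPt (hp : p ≠ c₀) (hR : 0 < R) : ang c₀ (rayPt c₀ p R) = ang c₀ p := by
  have hd : 0 < dist p c₀ := dist_pos.2 hp
  have h : toC c₀ (rayPt c₀ p R) = ((R / dist p c₀ : ℝ) : ℂ) * toC c₀ p := by
    simp only [toC, rayPt, add_sub_cancel_left, map_smul]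
    rw [Complex.real_smul]
  show (Complex.arg (toC c₀ (rayPt c₀ p R)) : Real.Angle) = (Complex.arg (toC c₀ p) : Real.Angle)
  rw [h, Complex.arg_real_mul _ (div_pos hR hd)]

/-- The angle parameter of a ray point is that of `p`. [folklore] -/
theorem angleParam_rayPt (hp : p ≠ c₀) (hR : 0 < R) : angleParam c₀ (rayPt c₀ p R) = angleParam c₀ p := by
  unfold angleParam; rw [ang_rayPt hp hR]

end SquarePolar

/-! ## The radial boundary heights of the collar squares -/

namespace Foliation.ConePosition

open SquareGrid SquareGrid.Grid SquarePolar ConeSquare CollarRadius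

variable {B : Type*} [NormedAddCommGroup B] [NormedSpace ℝ B] {M : Type*} [TopologicalSpace M] {F : Foliation B M}
variable {Γ : C(I, F.GermSpace)} {τ₀ ε : ℝ} {Φ : I → ℝ → M} {c₀ : ℝ × ℝ} {L : ℝ} {hL : 0 < L} {G : ℝ × ℝ → M}
variable (P : ConePosition F G c₀ hL)

/-- The level of the collar disc at distance `R`. [folklore] -/
def collarLevel (τ₀ τ₁ L R : ℝ) : ℝ := levelOfParam τ₀ τ₁ (1 - R / L)

omit [NormedSpace ℝ B] in
/-- On the outer collar the level is affine in the distance. [folklore] -/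
theorem collarLevel_eq {τ₀ τ₁ L R : ℝ} (hL : 0 < L) (hR : 3 * L / 4 ≤ R) (hRL : R ≤ L) :
    collarLevel τ₀ τ₁ L R = τ₀ + (τ₁ - τ₀) * (4 * (1 - R / L)) := by
  have hs0 : 0 ≤ 1 - R / L := by rw [sub_nonneg, div_le_one hL]; exact hRL
  have hs1 : 1 - R / L ≤ 1 / 4 := by rw [sub_le_comm, le_div_iff₀ hL]; linarith
  exact levelOfParam_of_le hs0 hs1

/-- **The radial height function of a square**: the `e_Q`-height of the collar disc at the point
of the ray from `c₀` through the centre of `Q` at distance `R`. [folklore] -/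
def radialHt (q : Fin P.n × Fin P.n) (R : ℝ) : ℝ := height (P.box q) (G (rayPt c₀ (P.gr.centre q) R))

section Radial

variable (hΦ : IsFenceOn F Γ τ₀ ε Φ univ) (hcl : ∀ τ ∈ Ioo (τ₀ - ε) (τ₀ + ε), Φ 1 τ = Φ 0 τ) {τ₁ : ℝ}
  (hτI : uIcc τ₀ τ₁ ⊆ Ioo (τ₀ - ε) (τ₀ + ε)) (h01 : τ₁ ≠ τ₀)
  (hG : ∀ x, L / 2 ≤ dist x c₀ → G x = Φ (angleParam c₀ x) (levelOfParam τ₀ τ₁ (1 - dist x c₀ / L)))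
  (hGc : Continuous G)
  {q : Fin P.n × Fin P.n} (hq : ∀ x ∈ P.gr.sq q, 7 * L / 8 ≤ dist x c₀)
  (hskel : ∀ x ∈ sphere (P.gr.centre q) P.gr.ℓ, P.skel x = G x)

include hq in
omit [NormedSpace ℝ B] in
/-- The centre of an outer-collar square is not `c₀`, and the radius range of the square. [folklore] -/
theorem collar_radius_bounds : P.gr.centre q ≠ c₀ ∧ 7 * L / 8 ≤ dist (P.gr.centre q) c₀ - P.gr.ℓ ∧
    dist (P.gr.centre q) c₀ + P.gr.ℓ ≤ L := by
  have hℓ := P.gr.hℓ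
  set cq := P.gr.centre q with hcq
  have hcq0 : 7 * L / 8 ≤ dist cq c₀ := hq cq (P.gr.centre_mem_sq q)
  have hne : cq ≠ c₀ := fun h ↦ by rw [h, dist_self] at hcq0; linarith [hL]
  -- the nearest and farthest ray points of the square
  have hnear : rayPt c₀ cq (dist cq c₀ - P.gr.ℓ) ∈ P.gr.sq q := by
    show rayPt c₀ cq (dist cq c₀ - P.gr.ℓ) ∈ closedBall cq P.gr.ℓ
    rw [mem_closedBall, dist_rayPt_self hne, show dist cq c₀ - P.gr.ℓ - dist cq c₀ = -P.gr.ℓ by ring, abs_neg, abs_of_pos hℓ]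
  have hfar : rayPt c₀ cq (dist cq c₀ + P.gr.ℓ) ∈ P.gr.sq q := by
    show rayPt c₀ cq (dist cq c₀ + P.gr.ℓ) ∈ closedBall cq P.gr.ℓ
    rw [mem_closedBall, dist_rayPt_self hne, show dist cq c₀ + P.gr.ℓ - dist cq c₀ = P.gr.ℓ by ring, abs_of_pos hℓ]
  have hpos : 0 ≤ dist cq c₀ - P.gr.ℓ := by
    -- `ℓ ≤ 7L/8 ≤ dist cq c₀`? only `ℓ ≤ L`: use the near point when nonnegative, else trivial bound fails; argue directly
    by_contra h
    push Not at h
    -- then `c₀ ∈ sq q`, contradicting `hq`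
    have hc₀ : c₀ ∈ P.gr.sq q := by
      show c₀ ∈ closedBall cq P.gr.ℓ
      rw [mem_closedBall, dist_comm]; linarith
    have := hq c₀ hc₀
    rw [dist_self] at this; linarith [hL]
  refine ⟨hne, ?_, ?_⟩
  · have h := hq _ hnear
    rwa [dist_rayPt hne hpos] at h
  · have h := P.gr.sq_subset_S q hfar
    rw [show P.gr.S = closedBall c₀ L from grid_S hL P.hn, mem_closedBall, dist_rayPt hne (by linarith [hℓ])] at h
    exact h

include hΦ hcl hτI hG hq in
omit [NormedSpace ℝ B] in
/-- **Two points of an outer-collar square at the same distance from `c₀` have the same height**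
in the box of the square. [folklore] -/
theorem height_eq_of_dist_eq {x y : ℝ × ℝ} (hx : x ∈ P.gr.sq q) (hy : y ∈ P.gr.sq q) {R : ℝ}
    (hxR : dist x c₀ = R) (hyR : dist y c₀ = R) : height (P.box q) (G x) = height (P.box q) (G y) := by
  have hℓ := P.gr.hℓ
  obtain ⟨hne, hlo, hhi⟩ := P.collar_radius_bounds hq
  -- the connected set `C = sphere c₀ R ∩ sq q`
  set C : Set (ℝ × ℝ) := sphere c₀ R ∩ P.gr.sq q with hC
  have hRℓ : P.gr.ℓ < R := by
    have := hq x hx; rw [hxR] at this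
    have h2 : P.gr.ℓ ≤ dist (P.gr.centre q) c₀ - P.gr.ℓ - P.gr.ℓ + P.gr.ℓ := by linarith
    -- `ℓ < 7L/8 ≤ R` since `ℓ ≤ (dist - ℓ) ...`: from `hlo` and `hhi`, `2ℓ ≤ L - 7L/8`, so `ℓ ≤ L/16 < 7L/8 ≤ R`
    nlinarith [hlo, hhi, this]
  have hCpre : IsPreconnected C := isPreconnected_bigSphere_inter_closedBall hℓ hRℓ
  haveI : PreconnectedSpace C := isPreconnected_iff_preconnectedSpace.1 hCpre
  -- `G` on `C` is the fence horizontal at the level of `R`, read through the angle: leafwise continuous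
  have hRlo : L / 2 ≤ R := by rw [← hxR]; linarith [hq x hx]
  have hτR : levelOfParam τ₀ τ₁ (1 - R / L) ∈ Ioo (τ₀ - ε) (τ₀ + ε) := hτI (levelOfParam_mem τ₀ τ₁ _)
  set g₀ : I → F.LeafSpace := toLeafSpace ∘ fun a ↦ Φ a (levelOfParam τ₀ τ₁ (1 - R / L)) with hg₀
  have hg₀c : Continuous g₀ := hΦ.continuous_toLeafSpace hτR
  have hg₀01 : g₀ 0 = g₀ 1 := by
    show toLeafSpace (Φ 0 _) = toLeafSpace (Φ 1 _)
    rw [hcl _ hτR]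
  have hGC : ∀ z ∈ C, G z = Φ (angleParam c₀ z) (levelOfParam τ₀ τ₁ (1 - R / L)) := fun z hz ↦ by
    rw [hG z (by rw [mem_sphere.1 hz.1]; exact hRlo), mem_sphere.1 hz.1]
  have hC0 : C ⊆ {c₀}ᶜ := fun z hz h ↦ by
    have := mem_sphere.1 hz.1
    rw [h, dist_self] at this; linarith
  have hcontC : ContinuousOn (fun z ↦ (toLeafSpace (G z) : F.LeafSpace)) C := by
    refine ((continuousOn_comp_angleParam hg₀c hg₀01 c₀).mono hC0).congr fun z hz ↦ ?_
    show toLeafSpace (G z) = toLeafSpace (Φ (angleParam c₀ z) _)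
    rw [hGC z hz]
  have hgC : Continuous fun k : C ↦ (toLeafSpace (G (k : ℝ × ℝ)) : F.LeafSpace) :=
    continuousOn_iff_continuous_restrict.1 hcontC
  have hsrcC : ∀ k : C, ofLeafSpace (toLeafSpace (G (k : ℝ × ℝ)) : F.LeafSpace) ∈ (P.box q).source := fun k ↦
    F.subbox_subset_source (P.box_mem q) (P.apply_mem q q (P.gr.adj_refl q) _ k.2.2)
  have key := F.height_eq_of_leafwise (P.box_mem q) hgC hsrcC ⟨x, mem_sphere.2 hxR, hx⟩ ⟨y, mem_sphere.2 hyR, hy⟩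
  exact key

include hΦ hcl hτI hG hq in
omit [NormedSpace ℝ B] in
/-- **The boundary heights of an outer-collar square are the radial heights.** [folklore] -/
theorem height_eq_radialHt {x : ℝ × ℝ} (hx : x ∈ P.gr.sq q) : height (P.box q) (G x) = P.radialHt q (dist x c₀) := by
  obtain ⟨hne, hlo, hhi⟩ := P.collar_radius_bounds hq
  have hℓ := P.gr.hℓ
  -- the ray point at the distance of `x` lies in the square
  have hR0 : 0 ≤ dist x c₀ := dist_nonneg
  have hmem : rayPt c₀ (P.gr.centre q) (dist x c₀) ∈ P.gr.sq q := by
    show rayPt c₀ (P.gr.centre q) (dist x c₀) ∈ closedBall (P.gr.centre q) P.gr.ℓ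
    rw [mem_closedBall, dist_rayPt_self hne]
    have h := abs_dist_sub_le x (P.gr.centre q) c₀
    have hxq : dist x (P.gr.centre q) ≤ P.gr.ℓ := mem_closedBall.1 hx
    linarith
  exact P.height_eq_of_dist_eq hΦ hcl hτI hG hq hx hmem rfl (dist_rayPt hne hR0)

include hΦ hτI h01 hG hGc hq in
omit [NormedSpace ℝ B] in
/-- **The radial height function is strictly monotone on the radius range of the square.**
[folklore] -/
theorem strictMonoOn_or_strictAntiOn_radialHt :
    StrictMonoOn (P.radialHt q) (Icc (dist (P.gr.centre q) c₀ - P.gr.ℓ) (dist (P.gr.centre q) c₀ + P.gr.ℓ)) ∨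
    StrictAntiOn (P.radialHt q) (Icc (dist (P.gr.centre q) c₀ - P.gr.ℓ) (dist (P.gr.centre q) c₀ + P.gr.ℓ)) := by
  obtain ⟨hne, hlo, hhi⟩ := P.collar_radius_bounds hq
  have hℓ := P.gr.hℓ
  set cq := P.gr.centre q with hcq
  set a := dist cq c₀ - P.gr.ℓ with ha
  set b := dist cq c₀ + P.gr.ℓ with hb
  have hab : a ≤ b := by rw [ha, hb]; linarith
  have ha0 : 0 < a := by linarith [hL]
  -- ray points of radii in `[a, b]` are in the square
  have hmem : ∀ R ∈ Icc a b, rayPt c₀ cq R ∈ P.gr.sq q := fun R hR ↦ by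
    show rayPt c₀ cq R ∈ closedBall cq P.gr.ℓ
    rw [mem_closedBall, dist_rayPt_self hne, abs_le]
    constructor <;> linarith [hR.1, hR.2]
  have hsrc : ∀ R ∈ Icc a b, G (rayPt c₀ cq R) ∈ (P.box q).source := fun R hR ↦
    F.subbox_subset_source (P.box_mem q) (P.apply_mem q q (P.gr.adj_refl q) _ (hmem R hR))
  -- continuity on `[a, b]`
  have hcont : ContinuousOn (P.radialHt q) (Icc a b) := by
    have h1 : Continuous fun R ↦ G (rayPt c₀ cq R) := hGc.comp (continuous_rayPt c₀ cq)
    have h2 : ContinuousOn (fun z ↦ height (P.box q) z) (P.box q).source := fun z hz ↦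
      (continuous_snd.continuousAt.comp ((P.box q).continuousAt hz)).continuousWithinAt
    exact h2.comp h1.continuousOn hsrc
  refine strictMonoOn_or_strictAntiOn_of_locally_injOn hab hcont fun R₀ hR₀ ↦ ?_
  -- the formula through the fence on the ray: constant angle parameter `a⋆`
  set astar : I := angleParam c₀ cq with hastar
  set τf : ℝ → ℝ := fun R ↦ levelOfParam τ₀ τ₁ (1 - R / L) with hτf
  have hform : ∀ R ∈ Icc a b, P.radialHt q R = height (P.box q) (Φ astar (τf R)) := fun R hR ↦ by
    have hRpos : 0 < R := ha0.trans_le hR.1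
    show height (P.box q) (G (rayPt c₀ cq R)) = _
    rw [hG _ (by rw [dist_rayPt hne hRpos.le]; linarith [hR.1]), dist_rayPt hne hRpos.le, angleParam_rayPt hne hRpos]
  -- the height germ at `(a⋆, τf R₀)`
  have hτadm : ∀ R, τf R ∈ Ioo (τ₀ - ε) (τ₀ + ε) := fun R ↦ hτI (levelOfParam_mem τ₀ τ₁ _)
  have hsrc₀ : Φ astar (τf R₀) ∈ (P.box q).source := by
    have h := hsrc R₀ hR₀
    rwa [hG _ (by rw [dist_rayPt hne (ha0.trans_le hR₀.1).le]; linarith [hR₀.1]),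
      dist_rayPt hne (ha0.trans_le hR₀.1).le, angleParam_rayPt hne (ha0.trans_le hR₀.1)] at h
  obtain ⟨χ, ⟨κ, hκ, -, hχmono⟩, hev⟩ := hΦ.exists_height_germ (P.box_mem q) (hτadm R₀) hsrc₀
  -- pull back along `R ↦ (a⋆, τf R)`
  have hτc : Continuous τf := (continuous_levelOfParam τ₀ τ₁).comp (continuous_const.sub (continuous_id.div_const L))
  have hca : ContinuousAt (fun R ↦ ((astar, τf R) : I × ℝ)) R₀ := continuousAt_const.prodMk hτc.continuousAt
  have h1 : ∀ᶠ R in 𝓝 R₀, height (P.box q) (Φ astar (τf R)) = χ (τf R) := hca.eventually hev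
  have h2 : ∀ᶠ R in 𝓝 R₀, τf R ∈ Ioo (τf R₀ - κ) (τf R₀ + κ) :=
    hτc.continuousAt.preimage_mem_nhds (Ioo_mem_nhds (by linarith) (by linarith))
  obtain ⟨U, hU, hUsub⟩ : ∃ U ∈ 𝓝 R₀, ∀ R ∈ U, height (P.box q) (Φ astar (τf R)) = χ (τf R) ∧
      τf R ∈ Ioo (τf R₀ - κ) (τf R₀ + κ) := by
    obtain ⟨U, hU, h⟩ := (h1.and h2).exists_mem
    exact ⟨U, hU, h⟩
  refine ⟨U, hU, fun R hR R' hR' hRR' ↦ ?_⟩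
  -- `τf` is affine injective on `[a, b]`, `χ` injective on the germ interval
  have hχinj : InjOn χ (Ioo (τf R₀ - κ) (τf R₀ + κ)) := hχmono.elim StrictMonoOn.injOn StrictAntiOn.injOn
  rw [hform R hR.2, hform R' hR'.2, (hUsub R hR.1).1, (hUsub R' hR'.1).1] at hRR'
  have hτeq : τf R = τf R' := hχinj (hUsub R hR.1).2 (hUsub R' hR'.1).2 hRR'
  -- affine formula for `τf` on `[a, b] ⊆ [3L/4, L]`
  have haff : ∀ R'' ∈ Icc a b, τf R'' = τ₀ + (τ₁ - τ₀) * (4 * (1 - R'' / L)) := fun R'' hR'' ↦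
    collarLevel_eq hL (by linarith [hR''.1]) (hR''.2.trans hhi)
  rw [haff R hR.2, haff R' hR'.2] at hτeq
  have h01' : τ₁ - τ₀ ≠ 0 := sub_ne_zero.2 h01
  have : (1 - R / L) = (1 - R' / L) := by
    have h := mul_left_cancel₀ h01' (by linarith : (τ₁ - τ₀) * (4 * (1 - R / L)) = (τ₁ - τ₀) * (4 * (1 - R' / L)))
    linarith
  field_simp at this
  linarith

include hΦ hcl hτI h01 hG hGc hq hskel in
omit [NormedSpace ℝ B] in
/-- **The boundary heights of an outer-collar square are radial.** [folklore] -/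
theorem isRadial_bdryHt : ConeSquare.IsRadial c₀ (P.gr.centre q) P.gr.ℓ (P.bdryHt q) (P.radialHt q)
    (Icc (dist (P.gr.centre q) c₀ - P.gr.ℓ) (dist (P.gr.centre q) c₀ + P.gr.ℓ)) where
  eq x hx := by
    rw [P.bdryHt_apply, hskel x hx]
    exact P.height_eq_radialHt hΦ hcl hτI hG hq (P.gr.sphere_subset_sq q hx)
  mem x hx := by
    have h := abs_dist_sub_le x (P.gr.centre q) c₀
    rw [mem_sphere.1 hx] at h
    rw [abs_le] at h
    exact ⟨by linarith [h.1], by linarith [h.2]⟩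
  mono := P.strictMonoOn_or_strictAntiOn_radialHt hΦ hτI h01 hG hGc hq

end Radial

end Foliation.ConePosition

end Literature.Topology.FourManifolds
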